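import Summits.QuantumFields.BalabanUV.Beta.GAN24.CombForcingPairFormLevelZero
import Summits.QuantumFields.BalabanUV.Beta.GAN24.CombChartChargeLevelZeroEvenRow
import Summits.QuantumFields.BalabanUV.Beta.GAN24.CombChartCrossedLedgerFirstStep

/-!
# `BalabanUV.Beta.GAN24.CombChartChargeLevelZeroEvenRowClosed` — binder row G-an2-4 ∕ (CONV-C), TRANSFER-III, the (III′) (C)-campaign in branch (i) of E0∕E1: **THE OWNER's FILE-L DISPLAY
# (iv) — THE LEVEL `0 → 1` CONSERVATION ROW OF THE COMB-CHART TOWER's LEG-AND-BOND-SYMMETRISED ff CHARGE ON THE EVEN CLASSES — HOLDS UNCONDITIONALLY AT an1's RECORD AT THE PINS**, and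
# **MEMBER `1`'s `LS(zmode_Lc Ũ′_1)` IS A PAIR FORM** (any `cE`): the OWNER gan24-p1 g52's `CombChartChargeLevelZeroEvenRow.pairFormLS_zmode_memberOne_of_forcingPairForm ∕
# legBondSymEven_levelZero_of_forcingPairForm_forcingCrossed` with BOTH hypotheses DISCHARGED by leaf-01 g86 G `CombForcingPairFormLevelZero` (`hB0 0` =
# `pairFormLS_combForcing_level0_lit`; `hXF 0` = `crossed_zmode_combForcing_level0_pin` through the OWNER's `CombChartCrossedLedgerFirstStep.forcingCrossed_levelZero_iff_value_pin`)
# (G-an2-4 CRUX TEAM (2), leaf prover `b2b-balaban-gan24-formalise-leaf-01`, gen 86; journal [LEAF01-G86-INTENT-7]; OWNER's (α)(β) l.67522)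

NOT IN PRINT; OUR BOOKKEEPING ([folklore] two term-mode compositions BY NAME; 0 `def`, 0 cited fact, 0 `def … : Prop`, 0 sorry; no existing file touched).
HONEST FRAMING (cell contract, verbatim): «discharging `BetaPertH` makes Bałaban's UV stability UNCONDITIONAL — a real constructive-QFT result; it is NOT the continuum limit and NOT the
Clay problem.»  HONEST DEPENDENCY (verbatim): «continuum YM on T⁴ ⇐ BetaPertH ∧ nine spine estimates (0/9 proved); BetaPertH ⇐ (D1) ∧ (D4) ∧ CAP+tail; G-an2-4 gates asym, D1 and
NE2/3/4.»

WHAT (`d = 3`, `[NeZero Lc]`, an1's sym record `symTablesAn1S2 3 Lc cΛt` — its border `vh₂S` is ff∕mm-free by `rfl`; `Tc = c • wsym22 M`; `Ũ′_i := unitS₂_i T̃′♮_i` the OWNER's comb-chart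
tower member in `T2RecOf` letters):
* §1 **`pairFormLS_zmode_memberOne_an1`** (`cE₂ = Lc⁸`; `cE cVH cΛ cB c M` FREE): `∃ R antisym², ∀ κ κ′ κ₁ κ₂, LS(zmode_Lc Ũ′_1)(κκ′; inl κ₁, inl κ₂) = R κκ₁κ′κ₂ + R κ′κ₁κκ₂ + (R κκ₂κ′κ₁ + R κ′κ₂κκ₁)`;
* §2 **`legBondSymEven_levelZero_an1_pin`** (`cE = Lc⁴`, `cE₂ = Lc⁸`, `M ≠ 0`, `c = (8M²)⁻¹`; `cVH cΛ cΛt cB` free): for every EVEN reflection class `(κ,κ′;κ₁,κ₂)`,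
  `LS(zmode_Lc Ũ′_{0+1})(κκ′; inl κ₁, inl κ₂) = LS(zmode_Lc Ũ′_0)(κκ′; inl κ₁, inl κ₂)` — the OWNER's file-L display (iv) `hcons0e`, VERBATIM shape, NO hypothesis left.
WHAT THIS IS NOT: the rows at levels `i ≥ 1` (`hB0 i`, `hXF i`, `i ≥ 1`) are NOT here (behind (D)_comb ∕ (Z)_comb ∕ the level-`≥1` EE value); nothing of (d″) ∕ (C)_{≥1} ∕ the S-slot rows ∕ (Q-L) ∕ (hW, hWall);
NEVER «G-an2-4 closed» as (CONV-C); NOT D1, NOT `BetaPertH`, NOT continuum, NOT Clay.  2026-08-27.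
-/

noncomputable section

open Finset
open scoped BigOperators
open Literature.MathematicalPhysics.QuantumFieldTheory
open Literature.MathematicalPhysics.QuantumFieldTheory.Balaban1983to89
open Literature.MathematicalPhysics.QuantumFieldTheory.Balaban1983to89.Beta
open ExpKernelCalculus (MKer comp shiftK)
open OneStepResolventKernel (Fib)
open AffineAveraging (Site box toSite)
open SecondOrderResponse (W2SymOfK)
open BalabanStepJetsSucc (mmRead)
open BalabanStepW2 (K3OfK M2Of)
open WilsonVertex2Sym (wsym22)
open Summit.QuantumFields.BalabanUV.Beta.HessKerDressedUnits (unitK unitS)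
open Summit.QuantumFields.BalabanUV.Beta.SecondOrderUnits (unitM unitS₂ unitM₂)
open Summit.QuantumFields.BalabanUV.Beta.SpineRooted (T2RecOf)
open Summit.QuantumFields.BalabanUV.Beta.SymSecondOrderTablesAn1 (symTablesAn1S2)
open Summit.QuantumFields.BalabanUV.Beta.CombChartStepJets (GcombSh SpureCombOf)
open Summit.QuantumFields.BalabanUV.Beta.GAN24.CombesThomas (sfStep smStep)
open Summit.QuantumFields.BalabanUV.Beta.GAN24.BiStencilZeroMode (Tab zmode)
open PolarizationSign (reflSign)
open Summit.QuantumFields.BalabanUV.Beta.GAN24.CombChartChargeLevelZeroEvenRow (pairFormLS_zmode_memberOne_of_forcingPairForm legBondSymEven_levelZero_of_forcingPairForm_forcingCrossed)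
open Summit.QuantumFields.BalabanUV.Beta.GAN24.CombChartCrossedLedgerFirstStep (forcingCrossed_levelZero_iff_value_pin)
open Summit.QuantumFields.BalabanUV.Beta.GAN24.CombForcingPairFormLevelZero (pairFormLS_combForcing_level0_lit crossed_zmode_combForcing_level0_pin)

namespace Summit.QuantumFields.BalabanUV.Beta.GAN24.CombChartChargeLevelZeroEvenRowClosed

variable {Lc : ℕ} [NeZero Lc]

/-! ## §1 Member 1 of the comb-chart tower is a pair form at an1's record -/

/-- NOT IN PRINT; OUR BOOKKEEPING.  **`LS(zmode_Lc Ũ′_1)` IS AN ANTISYMMETRIC-PAIR FORM AT an1's RECORD** (`cE₂ = Lc⁸`; every other constant free): the OWNER's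
`pairFormLS_zmode_memberOne_of_forcingPairForm` at `tabs := symTablesAn1S2 3 Lc cΛt` with `hB0 0 := CombForcingPairFormLevelZero.pairFormLS_combForcing_level0_lit`. -/
theorem pairFormLS_zmode_memberOne_an1 (cΛt cE cVH cΛ : ℝ) {cE₂ : ℝ} (cB : ℝ) (hcE₂ : cE₂ = (Lc : ℝ) ^ (2 * (3 + 1))) (c : ℝ) (M : ℕ) :
    ∃ R : Fin (3 + 1) → Fin (3 + 1) → Fin (3 + 1) → Fin (3 + 1) → ℝ,
      (∀ a b c e : Fin (3 + 1), R b a c e = -R a b c e) ∧ (∀ a b c e : Fin (3 + 1), R a b e c = -R a b c e) ∧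
      ∀ κ κ' κ₁ κ₂ : Fin (3 + 1),
        (zmode Lc (unitS₂ (sfStep Lc (0 + 1)) (smStep 3 Lc (0 + 1)) (T2RecOf 3 Lc (GcombSh Lc) (SpureCombOf (symTablesAn1S2 3 Lc cΛt) cE cVH cΛ) (symTablesAn1S2 3 Lc cΛt).M cE₂ cB (c • wsym22 M) (symTablesAn1S2 3 Lc cΛt).vh₂S (symTablesAn1S2 3 Lc cΛt).mixFF (0 + 1))) κ κ' (Sum.inl κ₁) (Sum.inl κ₂)
      + zmode Lc (unitS₂ (sfStep Lc (0 + 1)) (smStep 3 Lc (0 + 1)) (T2RecOf 3 Lc (GcombSh Lc) (SpureCombOf (symTablesAn1S2 3 Lc cΛt) cE cVH cΛ) (symTablesAn1S2 3 Lc cΛt).M cE₂ cB (c • wsym22 M) (symTablesAn1S2 3 Lc cΛt).vh₂S (symTablesAn1S2 3 Lc cΛt).mixFF (0 + 1))) κ' κ (Sum.inl κ₁) (Sum.inl κ₂)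
      + (zmode Lc (unitS₂ (sfStep Lc (0 + 1)) (smStep 3 Lc (0 + 1)) (T2RecOf 3 Lc (GcombSh Lc) (SpureCombOf (symTablesAn1S2 3 Lc cΛt) cE cVH cΛ) (symTablesAn1S2 3 Lc cΛt).M cE₂ cB (c • wsym22 M) (symTablesAn1S2 3 Lc cΛt).vh₂S (symTablesAn1S2 3 Lc cΛt).mixFF (0 + 1))) κ κ' (Sum.inl κ₂) (Sum.inl κ₁)
      + zmode Lc (unitS₂ (sfStep Lc (0 + 1)) (smStep 3 Lc (0 + 1)) (T2RecOf 3 Lc (GcombSh Lc) (SpureCombOf (symTablesAn1S2 3 Lc cΛt) cE cVH cΛ) (symTablesAn1S2 3 Lc cΛt).M cE₂ cB (c • wsym22 M) (symTablesAn1S2 3 Lc cΛt).vh₂S (symTablesAn1S2 3 Lc cΛt).mixFF (0 + 1))) κ' κ (Sum.inl κ₂) (Sum.inl κ₁)))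
          = R κ κ₁ κ' κ₂ + R κ' κ₁ κ κ₂ + (R κ κ₂ κ' κ₁ + R κ' κ₂ κ κ₁) :=
  pairFormLS_zmode_memberOne_of_forcingPairForm (symTablesAn1S2 3 Lc cΛt) cE cVH cΛ cB hcE₂ c M (fun _ _ _ _ _ _ _ _ => rfl) (fun _ _ _ _ _ _ _ _ => rfl)
    (pairFormLS_combForcing_level0_lit (Lc := Lc) cΛt cE cVH cΛ cE₂ cB)

/-! ## §2 The level `0 → 1` row on the even classes, closed at the pins -/

set_option maxHeartbeats 400000 in
/-- NOT IN PRINT; OUR BOOKKEEPING.  **THE OWNER's FILE-L DISPLAY (iv), NO HYPOTHESIS LEFT** (an1's record; pins `cE = Lc⁴`, `cE₂ = Lc⁸`, `M ≠ 0`, `c = (8M²)⁻¹`): on every even reflection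
class the leg-and-bond-symmetrised ff cell charge of the comb-chart tower is conserved from level `0` to level `1` — the OWNER's
`legBondSymEven_levelZero_of_forcingPairForm_forcingCrossed` with `hB0 0 := pairFormLS_combForcing_level0_lit` and `hXF 0 :=` (`forcingCrossed_levelZero_iff_value_pin`).mpr of
`crossed_zmode_combForcing_level0_pin`. -/
theorem legBondSymEven_levelZero_an1_pin (cΛt cVH cΛ cB : ℝ) {cE cE₂ c : ℝ} {M : ℕ} (hcE : cE = (Lc : ℝ) ^ (3 + 1)) (hcE₂ : cE₂ = (Lc : ℝ) ^ (2 * (3 + 1)))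
    (hM : M ≠ 0) (hc : c = (8 * (M : ℝ) ^ 2)⁻¹)
    (κ κ' κ₁ κ₂ : Fin (3 + 1)) (heven : ¬ ∃ α : Fin 4, reflSign α κ * reflSign α κ' * reflSign α κ₁ * reflSign α κ₂ = -1) :
    (zmode Lc (unitS₂ (sfStep Lc (0 + 1)) (smStep 3 Lc (0 + 1)) (T2RecOf 3 Lc (GcombSh Lc) (SpureCombOf (symTablesAn1S2 3 Lc cΛt) cE cVH cΛ) (symTablesAn1S2 3 Lc cΛt).M cE₂ cB (c • wsym22 M) (symTablesAn1S2 3 Lc cΛt).vh₂S (symTablesAn1S2 3 Lc cΛt).mixFF (0 + 1))) κ κ' (Sum.inl κ₁) (Sum.inl κ₂)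
      + zmode Lc (unitS₂ (sfStep Lc (0 + 1)) (smStep 3 Lc (0 + 1)) (T2RecOf 3 Lc (GcombSh Lc) (SpureCombOf (symTablesAn1S2 3 Lc cΛt) cE cVH cΛ) (symTablesAn1S2 3 Lc cΛt).M cE₂ cB (c • wsym22 M) (symTablesAn1S2 3 Lc cΛt).vh₂S (symTablesAn1S2 3 Lc cΛt).mixFF (0 + 1))) κ' κ (Sum.inl κ₁) (Sum.inl κ₂)
      + (zmode Lc (unitS₂ (sfStep Lc (0 + 1)) (smStep 3 Lc (0 + 1)) (T2RecOf 3 Lc (GcombSh Lc) (SpureCombOf (symTablesAn1S2 3 Lc cΛt) cE cVH cΛ) (symTablesAn1S2 3 Lc cΛt).M cE₂ cB (c • wsym22 M) (symTablesAn1S2 3 Lc cΛt).vh₂S (symTablesAn1S2 3 Lc cΛt).mixFF (0 + 1))) κ κ' (Sum.inl κ₂) (Sum.inl κ₁)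
      + zmode Lc (unitS₂ (sfStep Lc (0 + 1)) (smStep 3 Lc (0 + 1)) (T2RecOf 3 Lc (GcombSh Lc) (SpureCombOf (symTablesAn1S2 3 Lc cΛt) cE cVH cΛ) (symTablesAn1S2 3 Lc cΛt).M cE₂ cB (c • wsym22 M) (symTablesAn1S2 3 Lc cΛt).vh₂S (symTablesAn1S2 3 Lc cΛt).mixFF (0 + 1))) κ' κ (Sum.inl κ₂) (Sum.inl κ₁)))
      = (zmode Lc (unitS₂ (sfStep Lc 0) (smStep 3 Lc 0) (T2RecOf 3 Lc (GcombSh Lc) (SpureCombOf (symTablesAn1S2 3 Lc cΛt) cE cVH cΛ) (symTablesAn1S2 3 Lc cΛt).M cE₂ cB (c • wsym22 M) (symTablesAn1S2 3 Lc cΛt).vh₂S (symTablesAn1S2 3 Lc cΛt).mixFF 0)) κ κ' (Sum.inl κ₁) (Sum.inl κ₂)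
      + zmode Lc (unitS₂ (sfStep Lc 0) (smStep 3 Lc 0) (T2RecOf 3 Lc (GcombSh Lc) (SpureCombOf (symTablesAn1S2 3 Lc cΛt) cE cVH cΛ) (symTablesAn1S2 3 Lc cΛt).M cE₂ cB (c • wsym22 M) (symTablesAn1S2 3 Lc cΛt).vh₂S (symTablesAn1S2 3 Lc cΛt).mixFF 0)) κ' κ (Sum.inl κ₁) (Sum.inl κ₂)
      + (zmode Lc (unitS₂ (sfStep Lc 0) (smStep 3 Lc 0) (T2RecOf 3 Lc (GcombSh Lc) (SpureCombOf (symTablesAn1S2 3 Lc cΛt) cE cVH cΛ) (symTablesAn1S2 3 Lc cΛt).M cE₂ cB (c • wsym22 M) (symTablesAn1S2 3 Lc cΛt).vh₂S (symTablesAn1S2 3 Lc cΛt).mixFF 0)) κ κ' (Sum.inl κ₂) (Sum.inl κ₁)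
      + zmode Lc (unitS₂ (sfStep Lc 0) (smStep 3 Lc 0) (T2RecOf 3 Lc (GcombSh Lc) (SpureCombOf (symTablesAn1S2 3 Lc cΛt) cE cVH cΛ) (symTablesAn1S2 3 Lc cΛt).M cE₂ cB (c • wsym22 M) (symTablesAn1S2 3 Lc cΛt).vh₂S (symTablesAn1S2 3 Lc cΛt).mixFF 0)) κ' κ (Sum.inl κ₂) (Sum.inl κ₁))) :=
  legBondSymEven_levelZero_of_forcingPairForm_forcingCrossed (symTablesAn1S2 3 Lc cΛt) cE cVH cΛ cB hcE₂ c M (fun _ _ _ _ _ _ _ _ => rfl) (fun _ _ _ _ _ _ _ _ => rfl)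
    (pairFormLS_combForcing_level0_lit (Lc := Lc) cΛt cE cVH cΛ cE₂ cB)
    (fun _ _ hab => (forcingCrossed_levelZero_iff_value_pin (symTablesAn1S2 3 Lc cΛt) cE cVH cΛ cB hcE₂ c M (fun _ _ _ _ _ _ _ _ => rfl) (fun _ _ _ _ _ _ _ _ => rfl) hab hM hc).mpr
      (crossed_zmode_combForcing_level0_pin (Lc := Lc) cΛt cVH cΛ cB hcE hcE₂ hab))
    κ κ' κ₁ κ₂ heven

end Summit.QuantumFields.BalabanUV.Beta.GAN24.CombChartChargeLevelZeroEvenRowClosed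

end
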